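import Summits.KontsevichZagierPeriods.Zeta5Search.Certificates.RecordRayDenominatorsBricksClass
import HarnessLib

/-!
# ζ(5) search — the record ray's DENOMINATORS, XI-f: class-law windows BELOW `θ = 1` (`n/2 < p < n`, `p ∤ n`) (p3 g6)

HONEST FRAMING: systematic search; no irrationality claim unless certified.

OUR work (Summit side; prover seat p3, generation 6).  File XI-d's source kind `3` reads the partner normaliser `N♯(b′)` through
`p > n`.  For a table window with `1/2 ≤ A` and `B < 1` no prime of the window divides `n` (`not_dvd_of_window` of file X-c),
so `v_p(N♯(b′))` has the ray value through `padicValRat_sharpNormaliser_bRecord'_of_not_dvd`: source kind `4`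
(`BWin.okClassH`, same pinned integer parts and the same class-law windows `cw : List CWin`), soundness `sound_of_okClassH`,
the extended check `ok4 cw = ok3 cw ∨ (okShape ∧ okClassH cw)` with `soundList_of_all_ok4`, `all_ok4_of_all_ok3`,
`all_ok4_of_all_ok(2)` and `record_exponent_of_table4`.  Valuation bookkeeping; every `γ < 1` — no irrationality content.
-/

noncomputable section

open Finset Real Filter Topology

namespace Summit.KontsevichZagierPeriods.Zeta5Search.RecordRay

open Summit.KontsevichZagierPeriods.Zeta5Search.DualSeries
open Summit.KontsevichZagierPeriods.Zeta5Search.DualSeriesDenominators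
open Summit.KontsevichZagierPeriods.Zeta5Search.WedgeDictionary
open Summit.KontsevichZagierPeriods.Zeta5Search.DualSeriesLemma19 (bRecord)
open Summit.KontsevichZagierPeriods.Zeta5Search.CasoratianValuation (casoratian shift)
open Summit.KontsevichZagierPeriods.Zeta5Search.ClusterValuation (bRec)

namespace BWin

/-- Source check, kind `4`: as kind `3` but for a table window with `1/2 ≤ A`, `B < 1` (`a₂ ≤ 2a₁`, `b₁ < b₂`; class-law window with
`2a₁ᶜ ≥ a₂ᶜ`, `0 < b₁ᶜ < 5248`). -/
def okClassH (cw : List CWin) (w : BWin) : Bool :=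
  (w.kind == 4) && decide (w.a2 ≤ 2 * w.a1) && decide (w.b1 < w.b2) &&
    match cw[w.idx]? with
    | some c =>
        decide (0 < c.a2) && decide (c.a2 ≤ 2 * c.a1) && decide (0 < c.b1) && decide (c.b1 < 5248) && decide (c.N0 ≤ 10496) &&
          decide (c.a1 * w.a2 ≤ w.a1 * c.a2) && decide (w.b1 * c.b2 ≤ c.b1 * w.b2) &&
          (w.okFloor 8 && w.okFloor 9 && w.okFloor 10 && w.okFloor 11 && w.okFloor 12 && w.okFloor 13 && w.okFloor 14 &&
            w.okFloor 15 && w.okFloor 16 && w.okFloor 17 && w.okFloor 18 && w.okFloor 25) &&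
          decide ((w.k : ℤ) ≤ 9 + w.vN + w.vN + c.B) && decide ((w.k : ℤ) ≤ 9 + w.vN + w.vN - w.vrho)
    | none => false

/-- The extended check: `ok3` (kinds 0–3) or a shape-checked class-law window below `θ = 1` (kind 4). -/
def ok4 (cw : List CWin) (w : BWin) : Bool := w.ok3 cw || (w.okShape && w.okClassH cw)

section Sound

variable {n p : ℕ}

/-- **Soundness, kind `4`**: a prime of a window inside a class-law window (`n/2 < p < n`) gets `p^k` through `cell_core`. -/
theorem sound_of_okClassH {cw : List CWin} (hcw : ∀ c ∈ cw, c.Holds) {w : BWin} (hs : w.okShape = true)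
    (h : w.okClassH cw = true) : w.Sound := by
  intro n p hn hp hlo hhi zW zV zW' zV' zU zU' hzW hzV hzW' hzV' hzU hzU'
  have hs' := hs
  simp only [okClassH, Bool.and_eq_true, beq_iff_eq, decide_eq_true_eq] at h
  obtain ⟨⟨⟨-, hwa⟩, hwb⟩, h⟩ := h
  split at h
  · rename_i c hc
    simp only [Bool.and_eq_true, decide_eq_true_eq] at h
    obtain ⟨⟨⟨⟨⟨⟨⟨⟨⟨hca2, hcaa⟩, hb1pos⟩, hcb1⟩, hcN⟩, hL⟩, hR⟩, hF⟩, hk1⟩, hk2⟩ := h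
    obtain ⟨⟨⟨⟨⟨⟨⟨⟨⟨⟨⟨f8, f9⟩, f10⟩, f11⟩, f12⟩, f13⟩, f14⟩, f15⟩, f16⟩, f17⟩, f18⟩, f25⟩ := hF
    simp only [okShape, Bool.and_eq_true, decide_eq_true_eq] at hs
    obtain ⟨⟨⟨⟨⟨ha1, ha2⟩, hb2⟩, hab⟩, -⟩, h41⟩ := hs
    have hcmem : c ∈ cw := List.mem_iff_getElem?.mpr ⟨w.idx, hc⟩
    have hn1 : 1 ≤ n := by omega
    have hnd : ¬ p ∣ n := not_dvd_of_window hp hn1 hlo hhi hwa hwb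
    have hclo : c.a1 * n < c.a2 * p := by
      have h3 : w.a2 * (c.a1 * n) < w.a2 * (c.a2 * p) := by
        calc w.a2 * (c.a1 * n) = (c.a1 * w.a2) * n := by ring
          _ ≤ (w.a1 * c.a2) * n := Nat.mul_le_mul_right n hL
          _ = c.a2 * (w.a1 * n) := by ring
          _ < c.a2 * (w.a2 * p) := Nat.mul_lt_mul_of_pos_left hlo hca2
          _ = w.a2 * (c.a2 * p) := by ring
      exact Nat.lt_of_mul_lt_mul_left h3
    have hnp2 : n < 2 * p := by
      have : c.a2 * n ≤ 2 * c.a1 * n := Nat.mul_le_mul_right n hcaa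
      have h2 : c.a2 * n < c.a2 * (2 * p) := by nlinarith
      exact Nat.lt_of_mul_lt_mul_left h2
    have hchi : c.b2 * p < c.b1 * n := by
      have h2 : w.b2 * (c.b2 * p) ≤ w.b2 * (c.b1 * n) := by
        calc w.b2 * (c.b2 * p) = c.b2 * (w.b2 * p) := by ring
          _ ≤ c.b2 * (w.b1 * n) := Nat.mul_le_mul_left _ hhi
          _ = (w.b1 * c.b2) * n := by ring
          _ ≤ (c.b1 * w.b2) * n := Nat.mul_le_mul_right n hR
          _ = w.b2 * (c.b1 * n) := by ring
      have hle : c.b2 * p ≤ c.b1 * n := Nat.le_of_mul_le_mul_left h2 hb2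
      rcases hle.lt_or_eq with hlt | heq
      · exact hlt
      · exfalso
        have hdvd : p ∣ c.b1 * n := ⟨c.b2, by rw [← heq]; ring⟩
        rcases (Nat.Prime.dvd_mul hp).1 hdvd with h1 | h1
        · exact absurd (Nat.le_of_dvd hb1pos h1) (by omega)
        · exact hnd h1
    have hp41 : p ≤ 41 * n := by
      have : w.b2 * p ≤ w.b2 * (41 * n) := by nlinarith
      exact Nat.le_of_mul_le_mul_left this hb2
    have hsq2 : 41 * n + 2 < p ^ 2 := by nlinarith
    have hsq : 41 * n < p ^ 2 := by omega
    have hp14 : 14 < p := by omega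
    have hp2 : p ≠ 2 := by omega
    have e8 := fl_eq hs' f8 hlo hhi
    have e9 := fl_eq hs' f9 hlo hhi
    have e10 := fl_eq hs' f10 hlo hhi
    have e11 := fl_eq hs' f11 hlo hhi
    have e12 := fl_eq hs' f12 hlo hhi
    have e13 := fl_eq hs' f13 hlo hhi
    have e14 := fl_eq hs' f14 hlo hhi
    have e15 := fl_eq hs' f15 hlo hhi
    have e16 := fl_eq hs' f16 hlo hhi
    have e17 := fl_eq hs' f17 hlo hhi
    have e18 := fl_eq hs' f18 hlo hhi
    have e25 := fl_eq hs' f25 hlo hhi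
    have hvN : padicValRat p (sharpNormaliser (bRecord n)) = w.vN := by
      rw [padicValRat_sharpNormaliser_bRecord hp (by omega), e12, e13, e14, e15, e16]; rfl
    have hvN' : padicValRat p (sharpNormaliser (bRecord' n)) = w.vN := by
      rw [padicValRat_sharpNormaliser_bRecord'_of_not_dvd hn1 hp hnd hp14 (by omega), e12, e13, e14, e15, e16]; rfl
    have hvr : padicValRat p (rhoOf (aRec n)) = w.vrho := by
      rw [padicValRat_rhoOf_aRec hp hp2 (by omega), e8, e9, e10, e11, e12, e13, e14, e15, e16, e17, e18, e25]; rfl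
    have hcas : casoratian (bRecord n) 7 ≠ 0 → c.B ≤ padicValRat p (casoratian (bRecord n) 7) := by
      intro hne
      rw [bRecord_eq_bRec] at hne ⊢
      exact hcw c hcmem n p (by omega) hp hclo hchi hsq2 hne
    exact cell_core hn1 hp hp41 hsq hvN hvN' hvr hcas (k := w.k) (by linarith) (by linarith) hzW hzV hzW' hzV' hzU hzU'
  · exact absurd h Bool.false_ne_true

/-- `ok4 ⇒ okShape`. -/
theorem okShape_of_ok4 {cw : List CWin} {w : BWin} (h : w.ok4 cw = true) : w.okShape = true := by
  simp only [ok4, Bool.or_eq_true, Bool.and_eq_true] at h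
  rcases h with h | ⟨hs, -⟩
  · exact okShape_of_ok3 h
  · exact hs

/-- `ok4 ⇒ Sound` (given the class-law windows). -/
theorem sound_of_ok4 {cw : List CWin} (hcw : ∀ c ∈ cw, c.Holds) {w : BWin} (h : w.ok4 cw = true) : w.Sound := by
  have h' := h
  simp only [ok4, Bool.or_eq_true, Bool.and_eq_true] at h'
  rcases h' with h1 | ⟨hs, hl⟩
  · exact sound_of_ok3 hcw h1
  · exact sound_of_okClassH hcw hs hl

end Sound

end BWin

namespace BrickAtlas

variable {l : List BWin}

/-- A list checked by `ok4` is sound (given the class-law windows). -/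
theorem soundList_of_all_ok4 {cw : List CWin} (hcw : ∀ c ∈ cw, c.Holds) (hok : l.all (BWin.ok4 cw) = true) :
    SoundList l := fun i =>
  have h := List.all_eq_true.1 hok _ (List.getElem_mem i.isLt)
  ⟨BWin.okShape_of_ok4 h, BWin.sound_of_ok4 hcw h⟩

/-- `ok3`-checked lists are `ok4`-checked. -/
theorem all_ok4_of_all_ok3 {cw : List CWin} (hok : l.all (BWin.ok3 cw) = true) : l.all (BWin.ok4 cw) = true := by
  rw [List.all_eq_true] at hok ⊢
  intro w hw
  have := hok w hw
  simp only [BWin.ok4, Bool.or_eq_true]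
  exact Or.inl this

/-- `ok2`-checked lists are `ok4`-checked. -/
theorem all_ok4_of_all_ok2 (cw : List CWin) (hok : l.all BWin.ok2 = true) : l.all (BWin.ok4 cw) = true :=
  all_ok4_of_all_ok3 (all_ok3_of_all_ok2 cw hok)

/-- `ok`-checked lists are `ok4`-checked. -/
theorem all_ok4_of_all_ok (cw : List CWin) (hok : l.all BWin.ok = true) : l.all (BWin.ok4 cw) = true :=
  all_ok4_of_all_ok3 (all_ok3_of_all_ok cw hok)

/-- **The exponent of a table checked by `ok4`.** -/
theorem record_exponent_of_table4 {cw : List CWin} (hcw : ∀ c ∈ cw, c.Holds) (hok : l.all (BWin.ok4 cw) = true)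
    (hch : chainSep l = true) {γ : ℝ} (hγ0 : 0 ≤ γ)
    (hγ : γ * ((((3815232 / 10000 - rateQ l : ℚ) : ℝ) + 2 / 100) + 8508768884 / 10 ^ 8) <
      8508768883 / 10 ^ 8 + 315452 / 10000) :
    ∀ᶠ n : ℕ in atTop, ∃ p : ℤ, ∃ q : ℕ, 1 ≤ q ∧ (q : ℚ) = ML l n * |(recordQ n : ℚ)| ∧ (p : ℚ) = ML l n * recordP n ∧
      |Literature.NumberTheory.Transcendental.zetaValue 5 - (recordP n : ℝ) / (recordQ n : ℝ)| < 1 / (q : ℝ) ^ γ :=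
  record_exponent_of_sound (soundList_of_all_ok4 hcw hok) hch hγ0 hγ

end BrickAtlas

end Summit.KontsevichZagierPeriods.Zeta5Search.RecordRay
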